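import Summits.ResolutionOfSingularities.ResolutionOfSingularities.Theorems.EquisingularLiftEquisingularLiftNatPlaneCurveUnobs
import Summits.ResolutionOfSingularities.ResolutionOfSingularities.Theorems.EquisingularLiftEquisingularLiftNatDirStepUnobsHostChange
import Literature.AlgebraicGeometry.Motives.HypersurfaceChartAlgebra
import Literature.AlgebraicGeometry.Motives.ProjectiveSpaceDehomogenize
import Mathlib.RingTheory.Polynomial.UniqueFactorization
import HarnessLib

/-!
# [OURS · L1 W4.5(b) · EL♮(3) · WIDTH TABLE D4, row D4-5 (iso-w2) — the host-curve certificate engine, consumer form]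
# EVERY IRREDUCIBLE PLANE CURVE IS UNOBSTRUCTED: `DirStepUnobs ℙ²_k univ _ V₊(F) _` for `F` irreducible homogeneous with a point off the curve

Crux chain w45b (cell `res-hironaka`, LADDER-RESOLUTION rung L, slot W4.5(b)), child EL♮(3) = stmt-ResolutionOfSingularities-20148; desk
res-L1-w45b-plan-1 R43 / WIDTH TABLE D4 row D4-5 («iso-w2 … (3c) `dirStepUnobs_planeCurve` = the line/host-curve certificate engine»).
res-L1-w45b-iso-w2 g2 (WIDTH seat D-0157 DOOR 1), `--supports stmt-ResolutionOfSingularities-20148 --as helper`.  OURS; NOT a statement of any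
manuscript; AI-written, weaker than expert review.  No `sorry`; standard axioms; DEF-FREE.

WHAT — exactly the 7 theorems of this file (namespace `…Sections.PlaneCurveSplit`).  ✓ `dirStepUnobs_planeCurve` (…NatPlaneCurveUnobs) asks for
RADICAL chart equations `F/X₁^d`, `F/X₂^d`; this file discharges that hypothesis from IRREDUCIBILITY of `F`, which is how customers meet it:
* `isRadical_span_toChart_of_isPrime`, `isRadical_span_toChart_of_isUnit`, `isPrime_span_of_irreducible` (transport / factoriality of `k[y₀,y₁]`),
  `isRadical_span_toChart_of_irreducible` — for `F ∈ k[X₀,X₁,X₂]` irreducible and homogeneous and ANY chart `i`, the ideal `(F/Xᵢ^d)` of the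
  chart ring `(k[X]_{Xᵢ})₀ ≅ k[y₀,y₁]` is radical: by Literature `irreducible_or_isUnit_dehomogenize` (Hartshorne I, proof of Prop. 2.2) the
  dehomogenisation is irreducible — hence prime in the factorial ring `k[y₀,y₁]` — or a unit (ideal `⊤`, radical as well);
* `isRadical_span_chartEqn_of_irreducible` — the same for the tree's `SmoothHypersurface.chartEqn F i hF`;
* **`dirStepUnobs_planeCurve_of_irreducible`** — `DirStepUnobs ℙ²_k univ _ V₊(F) _` for every field `k`, every IRREDUCIBLE homogeneous `F` of
  degree `d ≥ 1` with unit `X₀^d`-coefficient (i.e. `(1:0:0) ∉ V₊(F)`): lines, conics, every integral plane curve;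
* **`dirStepUnobs_nestCurve_of_model_iso`** — THE NEST-CURVE CERTIFICATE through the (H2) door ✓ `dirStepUnobs_of_model_iso`
  (…NatDirStepUnobsHostChange): ONE isomorphism `e : ℙ²_k ≅ redSub G' E` carrying `V₊(F)` onto `Z ⊆ E` gives the NEST clause `DirStepUnobs G' E _ Z _`.

Degenerate checks (by type): `hu` is load-bearing (`F = X₁` is irreducible but passes through `(1:0:0)`; the charts `D₊(X₁)`, `D₊(X₂)` would not
cover it); `Irreducible F` excludes `F = 0` and units; non-reduced `F = G²` is excluded (irreducible), as it must be (`V₊(G²)` has ideal `(G)`, not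
`(G²)`).  HONEST SCOPE: model-level + the (H2) door; counted 0; EL♮(3) is NOT proved; resolution in characteristic `p` is NOT proved here (dim 3 is
Cossart–Piltant 2008/2009 in print).

References (index only): R. Hartshorne, *Algebraic Geometry* (1977), I proof of Prop. 2.2 / Ex. 2.10, III Thm. 5.1 [cite: Hartshorne1977].
-/

set_option linter.dupNamespace false -- mandated namespace `Summit.<Summit>.<Problem>` of this single-conjunct summit

noncomputable section

open CategoryTheory AlgebraicGeometry Opposite TopologicalSpace MvPolynomial HomogeneousLocalization
open Literature.AlgebraicGeometry.Motives Literature.AlgebraicGeometry.Motives.ProjectiveSpace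

attribute [local instance] MvPolynomial.gradedAlgebra ProjBaseChange.algebraBase

namespace Summit.ResolutionOfSingularities.ResolutionOfSingularities.Cruxes.EquisingularLiftNat.Sections

namespace PlaneCurveSplit

variable (k : Type) [Field k]

/-- Transport: a PRIME principal ideal `(p) ⊂ k[y₀,y₁]` gives a radical ideal `(toChart p)` of the chart ring `(k[X]_{Xᵢ})₀`
(`chartAlgEquiv`). [folklore] -/
theorem isRadical_span_toChart_of_isPrime (i : Fin 3) (p : MvPolynomial (Fin 2) k) (hp : (Ideal.span {p}).IsPrime) :
    (Ideal.span {toChart k i p}).IsRadical := by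
  have h : Ideal.span {toChart k i p} = Ideal.map (chartAlgEquiv k i).symm (Ideal.span {p}) := by
    rw [Ideal.map_span, Set.image_singleton]; rfl
  rw [h]
  haveI := hp
  exact (Ideal.map_isPrime_of_equiv (chartAlgEquiv k i).symm (I := Ideal.span {p})).isRadical

/-- Transport: a UNIT `p` gives the radical ideal `(toChart p) = ⊤`. [folklore] -/
theorem isRadical_span_toChart_of_isUnit (i : Fin 3) (p : MvPolynomial (Fin 2) k) (hp : IsUnit p) :
    (Ideal.span {toChart k i p}).IsRadical := by
  rw [Ideal.span_singleton_eq_top.mpr (hp.map _)]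
  exact (Ideal.radical_top _).le

/-- In the factorial ring `k[y₀,y₁]` an irreducible `p` generates a prime ideal. [folklore] -/
theorem isPrime_span_of_irreducible (p : MvPolynomial (Fin 2) k) (hir : Irreducible p) : (Ideal.span {p}).IsPrime :=
  (Ideal.span_singleton_prime hir.ne_zero).mpr (UniqueFactorizationMonoid.irreducible_iff_prime.mp hir)

/-- For `F ∈ k[X₀,X₁,X₂]` irreducible and homogeneous, the ideal `(F/Xᵢ^d) ⊂ (k[X]_{Xᵢ})₀` of ANY chart is radical: the dehomogenisation is
irreducible (hence prime, `k[y₀,y₁]` being factorial) or a unit (ideal `⊤`). [cite: Hartshorne1977, I proof of Prop. 2.2 / Ex. 2.10] -/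
theorem isRadical_span_toChart_of_irreducible (i : Fin 3) {d : ℕ} {F : MvPolynomial (Fin 3) k} (hF : F.IsHomogeneous d)
    (hirr : Irreducible F) : (Ideal.span {toChart k i (dehomogenize k i F)}).IsRadical := by
  rcases irreducible_or_isUnit_dehomogenize (i := i) hF hirr with hir | hun
  · exact isRadical_span_toChart_of_isPrime k i _ (isPrime_span_of_irreducible k _ hir)
  · exact isRadical_span_toChart_of_isUnit k i _ hun

/-- The chart equations `SmoothHypersurface.chartEqn F i hF = F/Xᵢ^d` of an irreducible homogeneous `F` generate radical ideals, on every chart.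
[cite: Hartshorne1977, I proof of Prop. 2.2 / Ex. 2.10] -/
theorem isRadical_span_chartEqn_of_irreducible (i : Fin 3) {d : ℕ} {F : MvPolynomial (Fin 3) k} (hF : F.IsHomogeneous d)
    (hirr : Irreducible F) : (Ideal.span {SmoothHypersurface.chartEqn F i hF}).IsRadical := by
  rw [SmoothHypersurface.chartEqn, isLocalizationElem_X]
  exact isRadical_span_toChart_of_irreducible k i hF hirr

/-- **EVERY IRREDUCIBLE PLANE CURVE IS UNOBSTRUCTED** — `DirStepUnobs ℙ²_k univ _ V₊(F) _` for every field `k` and every irreducible homogeneous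
`F` of degree `d ≥ 1` with unit `X₀^d`-coefficient (`(1:0:0) ∉ V₊(F)`): `Ȟ¹(C, 𝒩_{C/ℙ²}) = Ȟ¹(C, 𝒪_C(d)) = 0`. (✓ `dirStepUnobs_planeCurve` with its
radicality hypotheses discharged by `isRadical_span_chartEqn_of_irreducible`.)
[OURS · L1 W4.5b · EL♮(3) · WIDTH TABLE D4 row D4-5 (iso-w2); NOT a statement of the manuscript] -/
theorem dirStepUnobs_planeCurve_of_irreducible {d : ℕ} (F : MvPolynomial (Fin 3) k) (hF : F.IsHomogeneous d) (hd : 0 < d)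
    (hu : IsUnit (coeff (Finsupp.single 0 d) F)) (hirr : Irreducible F) :
    DirStepUnobs (Proj (homogeneousSubmodule (Fin 3) k)) Set.univ isClosed_univ
      (SmoothHypersurface.zeroLocusClosed F : Set _) (SmoothHypersurface.zeroLocusClosed F).isClosed :=
  dirStepUnobs_planeCurve F hF hd hu (isRadical_span_chartEqn_of_irreducible k 1 hF hirr) (isRadical_span_chartEqn_of_irreducible k 2 hF hirr)

/-- **THE NEST-CURVE CERTIFICATE (door (ii), one isomorphism)**: for a closed `E ⊆ G'` (the fresh plane of a point step), a closed `Z ⊆ E` and ONE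
isomorphism `e : ℙ²_k ≅ redSub G' E` carrying the model curve `V₊(F)` (`F` irreducible homogeneous of degree `d ≥ 1`, unit `X₀^d`-coefficient) onto
`Z`, the NEST clause `DirStepUnobs G' E _ Z hZ` holds. (`dirStepUnobs_planeCurve_of_irreducible` through ✓ (H2) `dirStepUnobs_of_model_iso`.)
[OURS · L1 W4.5b · EL♮(3) · WIDTH TABLE D4 row D4-5 (iso-w2); NOT a statement of the manuscript] -/
theorem dirStepUnobs_nestCurve_of_model_iso {d : ℕ} (F : MvPolynomial (Fin 3) k) (hF : F.IsHomogeneous d) (hd : 0 < d)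
    (hu : IsUnit (coeff (Finsupp.single 0 d) F)) (hirr : Irreducible F)
    (G' : Scheme.{0}) (E : Set G') (hE : IsClosed E) (Z : Set G') (hZ : IsClosed Z) (hZE : Z ⊆ E)
    (e : Proj (homogeneousSubmodule (Fin 3) k) ≅ redSub G' E hE)
    (he : (e.hom : Proj (homogeneousSubmodule (Fin 3) k) → redSub G' E hE) '' (SmoothHypersurface.zeroLocusClosed F : Set _) =
      (redSubι G' E hE : redSub G' E hE → G') ⁻¹' Z) :
    DirStepUnobs G' E hE Z hZ :=
  dirStepUnobs_of_model_iso (Proj (homogeneousSubmodule (Fin 3) k)) _ _ (dirStepUnobs_planeCurve_of_irreducible k F hF hd hu hirr)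
    G' E hE Z hZ hZE e he

end PlaneCurveSplit

end Summit.ResolutionOfSingularities.ResolutionOfSingularities.Cruxes.EquisingularLiftNat.Sections

end
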